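import Literature.Geometry.Riemannian.BaerHankeNormalFormProofs
import HarnessLib

/-!
# Stub `stub_bh27` of the lines `registered` and `swap-sum` (crux `CorkRegluablePsc`, stmt-SmoothPoincare4-3206)

The registered stub `stub_bh27` of both skeletons `Cruxes/CorkRegluablePsc/Lines/birth.lean`
(line `registered`) and `Cruxes/CorkRegluablePsc/Lines/swap_sum.lean` (line `swap-sum`) is
LITERALLY the tree's named fact
`Literature.Geometry.Riemannian.BarHanke2023_thm27_umbilicNormalForm` (Bär–Hanke 2023, §3
Thm. 27 with Def. 21, case `K = pt`, `σ = 0`, umbilic `k = μ g₀`: a PSC metric with outward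
mean curvature `H ≥ 3λ` can be deformed, keeping the induced boundary form and `scal > 0`, to the
`C`-normal form `dt² + (1 - 2λt - Ct²) g₀` near the boundary, for every `C ≥ C₀`), vendored in
`Literature/Geometry/Riemannian/BaerHankeNormalForm.lean` (p155406).  The fact is now DISCHARGED
in the tree by `Literature.Geometry.Riemannian.BarHanke2023_thm27_umbilicNormalForm_holds`
(`Literature/Geometry/Riemannian/BaerHankeNormalFormProofs.lean`: the reduction
`BarHanke2023_thm27_umbilicNormalForm_of_cylinderDeformation` fed with the cylinder deformation
core assembled from Bär–Hanke's Props. 23 and 26), so the stub closes by `exact`.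

* `stub_bh27` — the registered signature, closed by the discharge.

[cite: BarHanke2023, §3 Thm. 27, Def. 21, Props. 23, 26 (arXiv:2012.09127)]
-/

-- the prescribed namespace `Summit.<P>.<Sub>.…` duplicates `SmoothPoincare4` (P = Sub)
set_option linter.dupNamespace false

namespace Summit.SmoothPoincare4.SmoothPoincare4.Theorems

/-- **Stub `stub_bh27` (Bär–Hanke 2023, Thm. 27, umbilic C-normal form)**: the named fact
`Literature.Geometry.Riemannian.BarHanke2023_thm27_umbilicNormalForm`, closed by the tree's
discharge `BarHanke2023_thm27_umbilicNormalForm_holds`.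
[cite: BarHanke2023, §3 Thm. 27 with Def. 21 (arXiv:2012.09127)] -/
theorem stub_bh27 : Literature.Geometry.Riemannian.BarHanke2023_thm27_umbilicNormalForm :=
  Literature.Geometry.Riemannian.BarHanke2023_thm27_umbilicNormalForm_holds

end Summit.SmoothPoincare4.SmoothPoincare4.Theorems
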